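import Summits.Ventures.CertifiedManyBodySolver.Downfold.EmeryAxialResolventLevel
import Summits.Ventures.CertifiedManyBodySolver.Downfold.EmeryAxialWeightProfile
import HarnessLib

/-!
# Body-centred stacking: the interlayer structure factor `cos²(k_x/2)cos²(k_y/2) = (1 − x)(1 − y)` is LINEAR in `u` on every σ contour and vanishes at the
# antinode; the first-order c-axis hopping² profile of a bct stack in closed form; the exact c-axis width `≤ 16t⊥·cos(k_x/2)cos(k_y/2)`

Venture CertifiedManyBodySolver, cell `pub/hubbard-downfold` (stage S1; INFLATION-RULES-3to1-B §B.80 (i) — the body-centred single-layer materials of the validation set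
(La₂₋ₓSrₓCuO₄ #13/M15…, Tl₂Ba₂CuO₆ M34, Bi-2201 M33-class) carry `tperp/t` rows of the bct class «four `t_z(a/2, a/2, c/2)` bonds»; the S3 cell's interlayer input I2
uses their FS-average / FS-maximum), seat hubbard-downfold-mod-4 (technique B, g32); namespace `Summit.Ventures.CertifiedManyBodySolver.Downfold.Emery`. Sequel of
`EmeryAxialWeightProfile` (`vsq_on_contour`, `axialLin_node_form`: `w_s = (4a′γ₁/fsN)(u − u_node)/W4`) and `EmeryAxialResolventLevel` (`root_split_bracket`,
`sLevel_strictMonoOn`). Everything PROVED (0 sorry). WHAT THIS IS NOT: a statement about any material; `ε_s`, `t_sp`, `t⊥` are model inputs (`a′` free); only the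
Cu-4s–Cu-4s interlayer path to the 4 + 4 body-centred neighbours is modelled (no `s–p`, `p–p` interlayer terms, no apical `p_z` detail, no dimpling); U = 0 one-body algebra.

The setting. In a body-centred tetragonal stack each Cu-4s orbital couples to the four Cu-4s orbitals of the next plane at `(±a/2, ±a/2, c/2)`; the Bloch sum of
that coupling is `8t⊥·cos(k_x/2)cos(k_y/2)·cos(k_z c/2)`, so at fixed `(k_x, k_y, k_z)` the single-layer four-orbital model applies with the k-DEPENDENT axial level
`ε_s − 8t⊥ cos(k_x/2)cos(k_y/2) cos(k_z c/2)` [XiangWu2022, Eq. (2.45): `t_c ∝ cos(k_a/2)cos(k_b/2)(cos k_a − cos k_b)²`].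

* §1 `cos_half_sq_eq_one_sub`: `cos²(k/2) = 1 − x` (`x = sin²(k/2)`); **`bct_factor_on_contour`**: on the `ε`-contour `(1 − x)(1 − y) = (1 + fsD/(4fsN))·(1 + y_a − u)`,
  `u = x + y`, `y_a = yFace` — the bct structure factor² is LINEAR in `u` and vanishes at the antinodal sum `u_an = 1 + y_a` (the zone face `k_x = π`).
* §2 **THE bct c-AXIS PROFILE LAW** (first order, fixed-Fermi-surface coordinates): `t_z(k)² ∝ cos²(k_x/2)cos²(k_y/2)·w_s(k)²` with
  `w_s²·(1 − x)(1 − y)·(fsN·W4)² = 16a′²γ₁²·(1 + fsD/(4fsN))·(u − u_node)²·(u_an − u)` (`bct_caxis_profile_law`): a DOUBLE zero at the node, a SIMPLE zero (in `t_z²`) at the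
  antinode, over the squared affine energy denominator `W4(u)²` — against the heuristic `cos²(k_x/2)cos²(k_y/2)(cos k_x − cos k_y)⁴ ∝ (u_an − u)(u − u_node)²(u + u_node + fsD/fsN)²`
  (`bct_heuristic_on_contour`), whose extra factor `(u + u_node + fsD/fsN)²/W4(u)²`-mismatch is the square of the §B.80 (g) profile ratio.
* §3 EXACT (all orders in `t⊥`): at fixed `k∥` two `k_z` values whose CuO₂-band energies lie in one band window differ by at most the level difference
  `8t⊥cos(k_x/2)cos(k_y/2)·|Δcos(k_z c/2)| ≤ 16t⊥·cos(k_x/2)cos(k_y/2)` (`bct_stack_exact_width_le`), and coincide when the structure factor vanishes (`root_eq_of_level_eq`: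
  the level map is injective on a band window) — the c-axis dispersion of a bct stack vanishes EXACTLY on the zone face `k_x = π` (and on the diagonal by node blindness,
  `EmeryBilayerMirror.det_fourBandPP_sub_diag`): the «eight zeros» of the bct c-axis hopping on a zone Fermi surface, exactly.

Sources: [XiangWu2022, §2.7 Eqs. (2.44)–(2.45)]; [AndersenEtAl1995, §8]; [folklore] algebra.
-/

noncomputable section

namespace Summit.Ventures.CertifiedManyBodySolver.Downfold.Emery

open Real Set

/-! ## §1 The bct structure factor on a σ contour -/

/-- `cos²(k/2) = 1 − sin²(k/2)`. [folklore] -/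
theorem cos_half_sq_eq_one_sub (k : ℝ) : Real.cos (k / 2) ^ 2 = 1 - Real.sin (k / 2) ^ 2 := by
  have h := Real.sin_sq_add_cos_sq (k / 2)
  linarith

/-- **THE bct STRUCTURE FACTOR² IS LINEAR IN `u` ON THE CONTOUR AND VANISHES AT THE ANTINODE**: `(1 − x)(1 − y) = (1 + fsD/(4fsN))·(1 + y_a − (x + y))`
(`fsN ≠ 0`, face denominator `≠ 0`). [folklore] -/
theorem bct_factor_on_contour {Δ tpd tpp c x y ε : ℝ} (hN : fsN tpd tpp c ε ≠ 0) (hF : 4 * fsD Δ tpd c ε + 16 * fsN tpd tpp c ε ≠ 0)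
    (hP : charCubic Δ tpd tpp c x y ε = 0) :
    (1 - x) * (1 - y) = (1 + fsD Δ tpd c ε / (4 * fsN tpd tpp c ε)) * (1 + yFace Δ tpd tpp c ε - (x + y)) := by
  rw [charCubic_bilinear] at hP
  -- division-free form: `16fsN·(1 − x)(1 − y) = (4fsD + 16fsN)(1 − u) + (cA − 4fsD)`
  have key : 16 * fsN tpd tpp c ε * ((1 - x) * (1 - y)) =
      (4 * fsD Δ tpd c ε + 16 * fsN tpd tpp c ε) * (1 - (x + y)) + (cA Δ ε - 4 * fsD Δ tpd c ε) := by
    linear_combination (-1 : ℝ) * hP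
  unfold yFace
  have h16 : (16 : ℝ) * fsN tpd tpp c ε ≠ 0 := mul_ne_zero (by norm_num) hN
  have e1 : 1 + fsD Δ tpd c ε / (4 * fsN tpd tpp c ε) = (4 * fsD Δ tpd c ε + 16 * fsN tpd tpp c ε) / (16 * fsN tpd tpp c ε) := by
    field_simp
    ring
  rw [e1]
  generalize hFdef : 4 * fsD Δ tpd c ε + 16 * fsN tpd tpp c ε = F at hF key ⊢
  have e2 : 1 + (cA Δ ε - 4 * fsD Δ tpd c ε) / F - (x + y) = (F * (1 - (x + y)) + (cA Δ ε - 4 * fsD Δ tpd c ε)) / F := by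
    field_simp
    ring
  rw [e2, div_mul_div_comm, eq_div_iff (mul_ne_zero h16 hF)]
  linear_combination F * key

/-- The heuristic bct form factor² on the contour: `(1 − x)(1 − y)·(x − y)⁴ = (1 + fsD/(4fsN))(u_an − u)·[(u − u_node)(u + u_node + fsD/fsN)]²`. [folklore] -/
theorem bct_heuristic_on_contour {Δ tpd tpp c x y ε : ℝ} (hN : fsN tpd tpp c ε ≠ 0) (hN1 : fsN1 tpd tpp c ε ≠ 0)
    (hF : 4 * fsD Δ tpd c ε + 16 * fsN tpd tpp c ε ≠ 0) (hP : charCubic Δ tpd tpp c x y ε = 0) :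
    (1 - x) * (1 - y) * ((x - y) ^ 2) ^ 2 =
      (1 + fsD Δ tpd c ε / (4 * fsN tpd tpp c ε)) * (1 + yFace Δ tpd tpp c ε - (x + y)) *
        ((x + y - 2 * xNode Δ tpd tpp c ε) * (x + y + 2 * xNode Δ tpd tpp c ε + fsD Δ tpd c ε / fsN tpd tpp c ε)) ^ 2 := by
  rw [bct_factor_on_contour hN hF hP, vsq_on_contour hN hN1 hP]

/-! ## §2 The first-order c-axis profile law of a bct stack -/

/-- **THE bct c-AXIS PROFILE LAW** (fixed Fermi surface: frozen couplings `t̄`, direct `t̄ − α`, `T = α(ε_s − ε)`, slope `a′ = α/(ε_s − ε)`; contour point; `fsN, fsN1, fsT ≠ 0`, face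
denominator `≠ 0`, `W4 ≠ 0`): `w_s²·(1 − x)(1 − y)·(fsN·W4)² = 16a′²γ₁²·(1 + fsD/(4fsN))·(u − 2x_node)²·(1 + y_a − u)` — the squared first-order c-axis hopping
`t_z(k)² = 16t⊥²cos²(k_x/2)cos²(k_y/2)·w_s(k)²` of a bct stack in closed form along the Fermi surface. [cite: XiangWu2022, Eq. (2.45)] -/
theorem bct_caxis_profile_law {Δ εs tpd tpp c α T x y ε : ℝ} (hε : εs - ε ≠ 0) (hTα : T = α * (εs - ε))
    (hP : charCubic Δ tpd tpp c x y ε = 0) (hN : fsN tpd tpp c ε ≠ 0) (hN1 : fsN1 tpd tpp c ε ≠ 0) (hT : fsT Δ tpd tpp c ε ≠ 0)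
    (hF : 4 * fsD Δ tpd c ε + 16 * fsN tpd tpp c ε ≠ 0) (hW4 : W4 Δ tpd tpp c (α / (εs - ε)) x y ε ≠ 0) :
    sWeight4 Δ εs tpd (tpp - α) (c - α) T x y ε ^ 2 * ((1 - x) * (1 - y)) * (fsN tpd tpp c ε * W4 Δ tpd tpp c (α / (εs - ε)) x y ε) ^ 2 =
      16 * (α / (εs - ε)) ^ 2 * axialGamma1 Δ tpd tpp c ε ^ 2 * (1 + fsD Δ tpd c ε / (4 * fsN tpd tpp c ε)) *
        (x + y - 2 * xNode Δ tpd tpp c ε) ^ 2 * (1 + yFace Δ tpd tpp c ε - (x + y)) := by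
  have hw : sWeight4 Δ εs tpd (tpp - α) (c - α) T x y ε * (fsN tpd tpp c ε * W4 Δ tpd tpp c (α / (εs - ε)) x y ε) =
      4 * (α / (εs - ε)) * axialGamma1 Δ tpd tpp c ε * (x + y - 2 * xNode Δ tpd tpp c ε) := by
    rw [sWeight4_fixedFS hε hTα hP, axialLin_node_form hN hN1 hT hP]
    field_simp
  rw [bct_factor_on_contour hN hF hP]
  have e : sWeight4 Δ εs tpd (tpp - α) (c - α) T x y ε ^ 2 *
      ((1 + fsD Δ tpd c ε / (4 * fsN tpd tpp c ε)) * (1 + yFace Δ tpd tpp c ε - (x + y))) *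
      (fsN tpd tpp c ε * W4 Δ tpd tpp c (α / (εs - ε)) x y ε) ^ 2 =
      (sWeight4 Δ εs tpd (tpp - α) (c - α) T x y ε * (fsN tpd tpp c ε * W4 Δ tpd tpp c (α / (εs - ε)) x y ε)) ^ 2 *
        ((1 + fsD Δ tpd c ε / (4 * fsN tpd tpp c ε)) * (1 + yFace Δ tpd tpp c ε - (x + y))) := by ring
  rw [e, hw]
  ring

/-! ## §3 Exact statements for the bct stack -/

/-- **THE LEVEL MAP IS INJECTIVE ON A BAND WINDOW**: two four-orbital band points at the same `k`, `T ≥ 0` and the SAME axial level, both in one window `[a, b]` free of σ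
band energies (`x, y ≥ 0`), coincide. [folklore] -/
theorem root_eq_of_level_eq {Δ tpd tpp c T x y a b ℓ ε₁ ε₂ : ℝ} (hT : 0 ≤ T) (hx : 0 ≤ x) (hy : 0 ≤ y)
    (hm : ∀ e ∈ Icc a b, minor4S Δ tpd tpp c x y e ≠ 0) (h₁ : ε₁ ∈ Icc a b) (h₂ : ε₂ ∈ Icc a b)
    (r₁ : sec4 Δ ℓ tpd tpp c T x y ε₁ = 0) (r₂ : sec4 Δ ℓ tpd tpp c T x y ε₂ = 0) : ε₁ = ε₂ := by
  have e₁ := (sec4_eq_zero_iff_sLevel ℓ (hm _ h₁)).1 r₁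
  have e₂ := (sec4_eq_zero_iff_sLevel ℓ (hm _ h₂)).1 r₂
  exact (sLevel_strictMonoOn (T := T) hT hx hy hm).injOn h₁ h₂ (e₁.symm.trans e₂)

/-- **bct STACK, EXACTLY**: with the k∥-dependent interlayer amplitude `A = 8t⊥cos(k_x/2)cos(k_y/2) ≥ 0` and levels `ε_s − A·cos(k_z c/2)`, two `k_z` values whose
conduction-band energies at the same `k∥` lie in one band window satisfy `|ε′ − ε| ≤ A·|cos(k_z c/2) − cos(k_z′ c/2)| ≤ 2A` — the exact c-axis width is
`≤ 16t⊥cos(k_x/2)cos(k_y/2)` and vanishes where the structure factor does (zone face), to all orders. [cite: XiangWu2022, Eq. (2.45)] -/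
theorem bct_stack_exact_width_le {Δ εs tpd tpp c tsp A x y a b cz cz' ε ε' : ℝ} (hA : 0 ≤ A) (hx : 0 ≤ x) (hy : 0 ≤ y)
    (hm : ∀ e ∈ Icc a b, minor4S Δ tpd tpp c x y e ≠ 0) (he : ε ∈ Icc a b) (he' : ε' ∈ Icc a b)
    (hcz : cz ∈ Icc (-1 : ℝ) 1) (hcz' : cz' ∈ Icc (-1 : ℝ) 1)
    (r : sec4 Δ (εs - A * cz) tpd tpp c (tsp ^ 2) x y ε = 0) (r' : sec4 Δ (εs - A * cz') tpd tpp c (tsp ^ 2) x y ε' = 0) :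
    |ε' - ε| ≤ A * |cz - cz'| ∧ |ε' - ε| ≤ 2 * A := by
  have key : |ε' - ε| ≤ A * |cz - cz'| := by
    rcases lt_trichotomy (εs - A * cz) (εs - A * cz') with hlt | heq | hgt
    · have h := root_split_bracket (sq_nonneg tsp) hx hy hm he he' r r' hlt
      rw [abs_of_pos (by linarith [h.1])]
      have : ε' - ε ≤ A * (cz - cz') := by linarith [h.2]
      exact this.trans (mul_le_mul_of_nonneg_left (le_abs_self _) hA)
    · rw [heq] at r
      have := root_eq_of_level_eq (sq_nonneg tsp) hx hy hm he he' r r'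
      rw [this, sub_self, abs_zero]; positivity
    · have h := root_split_bracket (sq_nonneg tsp) hx hy hm he' he r' r hgt
      rw [abs_sub_comm, abs_of_pos (by linarith [h.1])]
      have : ε - ε' ≤ A * (cz' - cz) := by linarith [h.2]
      exact this.trans (mul_le_mul_of_nonneg_left (by rw [abs_sub_comm]; exact le_abs_self _) hA)
  refine ⟨key, key.trans ?_⟩
  have hd : |cz - cz'| ≤ 2 := by
    rw [abs_le]; constructor <;> linarith [hcz.1, hcz.2, hcz'.1, hcz'.2]
  nlinarith

/-- On the zone face `k_x = π` the bct amplitude vanishes (`cos(π/2) = 0`), so the level is `k_z`-independent and the two roots coincide: NO c-axis dispersion at the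
antinodal face, exactly. [cite: XiangWu2022, Eq. (2.45)] -/
theorem bct_stack_face_flat {Δ εs tpd tpp c tsp t x y a b cz cz' ε ε' : ℝ} (hx : 0 ≤ x) (hy : 0 ≤ y)
    (hm : ∀ e ∈ Icc a b, minor4S Δ tpd tpp c x y e ≠ 0) (he : ε ∈ Icc a b) (he' : ε' ∈ Icc a b)
    (r : sec4 Δ (εs - 8 * t * Real.cos (Real.pi / 2) * Real.cos (y / 2) * cz) tpd tpp c (tsp ^ 2) x y ε = 0)
    (r' : sec4 Δ (εs - 8 * t * Real.cos (Real.pi / 2) * Real.cos (y / 2) * cz') tpd tpp c (tsp ^ 2) x y ε' = 0) : ε = ε' := by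
  rw [Real.cos_pi_div_two] at r r'
  simp only [mul_zero, zero_mul, sub_zero] at r r'
  exact root_eq_of_level_eq (sq_nonneg tsp) hx hy hm he he' r r'

end Summit.Ventures.CertifiedManyBodySolver.Downfold.Emery
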